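import Summits.HubbardSuperconductivity.HubbardSuperconductivity.Theorems.KLProgrammeKLRegimeFlowReadScaleZeroSunsetCertReader

/-!
# Route `KLProgramme`, crux K3 — engine-flow child (stmt-HubbardSuperconductivity-20437), stub (C) at `n = 0`, located item #22a «(C)-SCALE0-PT2»:
# THE RECORD READER, part 2 — the assembly's certified rows `hS0` / `hSk` in `ℝ`, modulo the far sites

Seat hubbard-kl-k3c5-p1 (g14; owner of #22a).  Continuation of `…FlowReadScaleZeroSunsetCertReader` (§1–§4, the near rows in `ℝ≥0∞`):
* §5 `nearRow_le` — the near rows in the assembly's currency (`contr` factors via `norm_contr_gridCov_hubbardCovAboveCT`, real norms, the integer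
  Euclidean weight `√(|z_c 0|² + |z_c 1|²)ᵏ` = the record's `siteWeight k z_c`): `Σ_{p₁ near} w_k‖A₁(A₂A₃)‖ ≤ row k·(4M/β)`;
* §6 **`sunsetRows_of_certV3`** — THE HYPOTHESES `hS0` AND `hSk` (k = 1, 2) OF `twoLegRead_frameZero_of_sunsetData`, literally, with every
  `bS k ≥ row k + bFar k`, from `ScaleZeroSunsetCertV3 c`, `μ ∈ [μlo, μhi]`, `β ≥ klBetaMin`, `β/4M ≤ 2⁻¹⁰`, torus-tail parameters (`N′ ≥ 4`,
  `R + 1 + 2Rc ≤ L`), the ONE tail-smallness hypothesis `(β/klBetaMin)·(window + torus tail) ≤ Tmax`, `0 ≤ row k`, and the FAR-SITE remainder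
  `hfar` (sites with `z_c ∉ disk`; explicit input — located gap «(2e)-FAR-SITES», no supplier in the tree yet).  Per term: the assembly's summand is
  dominated by near + far (the Euclidean weight vanishes on site; the on-site indicator handles k = 0).

No definitions; nothing here asserts (C), any stub of 20437, K3 or superconductivity.
References: BGM 2006 §2.3 (2.17)–(2.20), §3 (3.2) [cite: BenfattoGiulianiMastropietro2006].
-/

noncomputable section

namespace Summit.HubbardSuperconductivity.HubbardSuperconductivity.Theorems.KLRegimeSplit

set_option linter.dupNamespace false -- summit = problem name (single-conjunct summit), D-0017

open Literature.MathematicalPhysics.QuantumLattice Literature.Probability.LatticeModels Literature.Analysis.FunctionSpaces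
open Summit.HubbardSuperconductivity.HubbardSuperconductivity.Theorems.DispersionFlow
open MeasureTheory Set Finset Complex UnitAddTorus Real GrassmannAlgebra Matrix
open scoped FourierTransform Nat ENNReal NNReal

variable {L M : ℕ} [NeZero L]

/-! ## §5 The near rows in `ℝ`, in the assembly's `contr` currency -/

omit [NeZero L] in
/-- The integer weight of the assembly equals the record's site weight at the centred representative. -/
theorem ofReal_sqrt_natAbs_pow_eq_siteWeight (k : Fin 3) (u : TorusSite 2 L) :
    ENNReal.ofReal (Real.sqrt ((((u 0).valMinAbs.natAbs : ℝ)) ^ 2 + (((u 1).valMinAbs.natAbs : ℝ)) ^ 2) ^ (k : ℕ)) =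
      SunsetCellRecordV2.siteWeight k (fun j => (u j).valMinAbs) := by
  simp only [SunsetCellRecordV2.siteWeight, Nat.cast_natAbs, Int.cast_abs, sq_abs]

/-- **NEAR ROW in `ℝ`** (the assembly's currency: `contr` factors, real norms, integer Euclidean weight): under the hypotheses of `nearRow_enorm_le`
and `0 ≤ row k`, `Σ_{p₁ : x₁ ≠ x₀, z_c ∈ disk} ‖z_c‖₂ᵏ·‖A₁·(A₂·A₃)‖ ≤ row k·(N/β)`. -/
theorem nearRow_le (c : SunsetCellRecordV3) (hc : ScaleZeroSunsetCertV3 c) {μ : ℝ} (hμlo : (c.μlo : ℝ) ≤ μ) (hμhi : μ ≤ c.μhi)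
    (k : Fin 3) (hrow : 0 ≤ (c.row k : ℝ)) {β : ℝ} (hβ : klBetaMin ≤ β) (hM : 0 < M) {N : ℕ} (hN : 0 < N)
    (hδ : β / N ≤ (2 : ℝ)⁻¹ ^ 10) {N' R : ℕ} (hN' : 2 * 2 ≤ N') (hR : R + 1 + 2 * c.Rc ≤ L)
    (hT : ENNReal.ofReal (β / klBetaMin) *
        ENNReal.ofReal ((19 / 3) * (4 + |μ| + (0 : TrigPolyC4v).coeffNorm 0) * β / (2 * π ^ 2 * M) +
            (N' ! * klChi2CauchyTab N' * (N' + 1) ! * 4 * (max 1 (4 / klE0)) ^ (N' - 1) * ((2 * π) * 4) ^ N') * (2 / klE0) *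
              (1 / (2 * Real.pi) ^ N' * (2 / ((2 * R + 2 : ℕ) : ℝ)) ^ (N' - 2 * 2) * (2 ^ 2 * ∑' k : Site 2, ∏ j, (1 + (k j : ℝ) ^ 2)⁻¹))) ≤
      ENNReal.ofReal (c.Tmax : ℝ))
    (σ σ' : Fin 2) (p₀ : GridPoint L N) :
    ∑ p₁ : GridPoint L N, (if p₁.2 ≠ p₀.2 ∧ (fun j => ((p₁.2 - p₀.2) j).valMinAbs : Site 2) ∈ c.disk then
        Real.sqrt ((((p₁.2 - p₀.2) 0).valMinAbs.natAbs : ℝ) ^ 2 + (((p₁.2 - p₀.2) 1).valMinAbs.natAbs : ℝ) ^ 2) ^ (k : ℕ) *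
          ‖contr ℂ ((hubbardGridSub L M β N).transpose * hubbardCovAboveCT L M β μ 0 0 klE0 * hubbardGridSub L M β N)
              (((p₁, σ), 0) : GridLeg (GridPoint L N)) ((p₀, σ), 1) *
            (contr ℂ ((hubbardGridSub L M β N).transpose * hubbardCovAboveCT L M β μ 0 0 klE0 * hubbardGridSub L M β N)
                (((p₀, σ'), 0) : GridLeg (GridPoint L N)) ((p₁, σ'), 1) *
              contr ℂ ((hubbardGridSub L M β N).transpose * hubbardCovAboveCT L M β μ 0 0 klE0 * hubbardGridSub L M β N)
                (((p₁, σ'), 0) : GridLeg (GridPoint L N)) ((p₀, σ'), 1))‖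
        else 0) ≤ (c.row k : ℝ) * ((N : ℝ) / β) := by
  classical
  have hβ₀ : (0 : ℝ) < klBetaMin := by norm_num [klBetaMin]
  have hβpos : 0 < β := lt_of_lt_of_le hβ₀ hβ
  have hE := nearRow_enorm_le (L := L) (M := M) c hc hμlo hμhi k hβ hM hN hδ hN' hR hT σ σ' p₀
  set Cg := (hubbardGridSub L M β N).transpose * hubbardCovAboveCT L M β μ 0 0 klE0 * hubbardGridSub L M β N with hCg
  -- every real term is nonnegative and its `ofReal` is the corresponding `ℝ≥0∞` term
  have hnn : ∀ p₁ ∈ (Finset.univ : Finset (GridPoint L N)), 0 ≤ (if p₁.2 ≠ p₀.2 ∧ (fun j => ((p₁.2 - p₀.2) j).valMinAbs : Site 2) ∈ c.disk then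
        Real.sqrt ((((p₁.2 - p₀.2) 0).valMinAbs.natAbs : ℝ) ^ 2 + (((p₁.2 - p₀.2) 1).valMinAbs.natAbs : ℝ) ^ 2) ^ (k : ℕ) *
          ‖contr ℂ Cg (((p₁, σ), 0) : GridLeg (GridPoint L N)) ((p₀, σ), 1) *
            (contr ℂ Cg (((p₀, σ'), 0) : GridLeg (GridPoint L N)) ((p₁, σ'), 1) * contr ℂ Cg (((p₁, σ'), 0) : GridLeg (GridPoint L N)) ((p₀, σ'), 1))‖
        else 0) := by
    intro p₁ _; split_ifs <;> positivity
  have hterm : ∀ p₁ : GridPoint L N, ENNReal.ofReal (if p₁.2 ≠ p₀.2 ∧ (fun j => ((p₁.2 - p₀.2) j).valMinAbs : Site 2) ∈ c.disk then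
        Real.sqrt ((((p₁.2 - p₀.2) 0).valMinAbs.natAbs : ℝ) ^ 2 + (((p₁.2 - p₀.2) 1).valMinAbs.natAbs : ℝ) ^ 2) ^ (k : ℕ) *
          ‖contr ℂ Cg (((p₁, σ), 0) : GridLeg (GridPoint L N)) ((p₀, σ), 1) *
            (contr ℂ Cg (((p₀, σ'), 0) : GridLeg (GridPoint L N)) ((p₁, σ'), 1) * contr ℂ Cg (((p₁, σ'), 0) : GridLeg (GridPoint L N)) ((p₀, σ'), 1))‖
        else 0) =
      (if p₁.2 ≠ p₀.2 ∧ (fun j => ((p₁.2 - p₀.2) j).valMinAbs : Site 2) ∈ c.disk then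
        SunsetCellRecordV2.siteWeight k (fun j => ((p₁.2 - p₀.2) j).valMinAbs) *
          ((‖Cg ((p₁, σ), 0) ((p₀, σ), 1)‖₊ : ℝ≥0∞) * ((‖Cg ((p₀, σ'), 0) ((p₁, σ'), 1)‖₊ : ℝ≥0∞) * (‖Cg ((p₁, σ'), 0) ((p₀, σ'), 1)‖₊ : ℝ≥0∞)))
        else 0) := by
    intro p₁
    split_ifs with h
    · rw [ENNReal.ofReal_mul (by positivity), ofReal_sqrt_natAbs_pow_eq_siteWeight, norm_mul, norm_mul,
        ENNReal.ofReal_mul (norm_nonneg _), ENNReal.ofReal_mul (norm_nonneg _), hCg,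
        norm_contr_gridCov_hubbardCovAboveCT, norm_contr_gridCov_hubbardCovAboveCT, norm_contr_gridCov_hubbardCovAboveCT,
        ofReal_norm, ofReal_norm, ofReal_norm]
      rfl
    · simp
  have hsum : ENNReal.ofReal (∑ p₁ : GridPoint L N, (if p₁.2 ≠ p₀.2 ∧ (fun j => ((p₁.2 - p₀.2) j).valMinAbs : Site 2) ∈ c.disk then
        Real.sqrt ((((p₁.2 - p₀.2) 0).valMinAbs.natAbs : ℝ) ^ 2 + (((p₁.2 - p₀.2) 1).valMinAbs.natAbs : ℝ) ^ 2) ^ (k : ℕ) *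
          ‖contr ℂ Cg (((p₁, σ), 0) : GridLeg (GridPoint L N)) ((p₀, σ), 1) *
            (contr ℂ Cg (((p₀, σ'), 0) : GridLeg (GridPoint L N)) ((p₁, σ'), 1) * contr ℂ Cg (((p₁, σ'), 0) : GridLeg (GridPoint L N)) ((p₀, σ'), 1))‖
        else 0)) ≤ ENNReal.ofReal ((c.row k : ℝ) * ((N : ℝ) / β)) := by
    rw [ENNReal.ofReal_sum_of_nonneg hnn, mul_comm (c.row k : ℝ), ENNReal.ofReal_mul (by positivity)]
    simp_rw [hterm]
    exact hE
  exact (ENNReal.ofReal_le_ofReal_iff (by positivity)).1 hsum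

/-! ## §6 The assembly's rows `hS0` / `hSk` from the near rows and a far-site remainder -/

/-- **THE CERTIFIED SUNSET ROWS OF THE ASSEMBLY, modulo the far sites**: for a μ-cell record `c` with `ScaleZeroSunsetCertV3 c`, `μ` in the cell,
`β ≥ klBetaMin`, grid `4M` with `β/4M ≤ 2⁻¹⁰`, torus-tail parameters `N′ ≥ 4`, `R + 1 + 2Rc ≤ L`, tails within the allowance, nonnegative rows, and a
FAR-SITE remainder `bFar k` for the sites with `z_c ∉ disk` (explicit input — no supplier in the tree yet), the hypotheses `hS0` and `hSk` (k = 1, 2) of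
`twoLegRead_frameZero_of_sunsetData` hold with every `bS k ≥ row k + bFar k`. -/
theorem sunsetRows_of_certV3 [NeZero M] (c : SunsetCellRecordV3) (hc : ScaleZeroSunsetCertV3 c) {μ : ℝ} (hμlo : (c.μlo : ℝ) ≤ μ)
    (hμhi : μ ≤ c.μhi) {β : ℝ} (hβ : klBetaMin ≤ β) (hδ : β / ((2 * (2 * M) : ℕ) : ℝ) ≤ (2 : ℝ)⁻¹ ^ 10)
    {N' R : ℕ} (hN' : 2 * 2 ≤ N') (hR : R + 1 + 2 * c.Rc ≤ L)
    (hT : ENNReal.ofReal (β / klBetaMin) *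
        ENNReal.ofReal ((19 / 3) * (4 + |μ| + (0 : TrigPolyC4v).coeffNorm 0) * β / (2 * π ^ 2 * M) +
            (N' ! * klChi2CauchyTab N' * (N' + 1) ! * 4 * (max 1 (4 / klE0)) ^ (N' - 1) * ((2 * π) * 4) ^ N') * (2 / klE0) *
              (1 / (2 * Real.pi) ^ N' * (2 / ((2 * R + 2 : ℕ) : ℝ)) ^ (N' - 2 * 2) * (2 ^ 2 * ∑' k : Site 2, ∏ j, (1 + (k j : ℝ) ^ 2)⁻¹))) ≤
      ENNReal.ofReal (c.Tmax : ℝ))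
    (hrow : ∀ k : Fin 3, 0 ≤ (c.row k : ℝ)) {bFar bS : ℕ → ℝ}
    (hfar : ∀ k : Fin 3, ∀ (σ : Fin 2) (p₀ : GridPoint L (2 * (2 * M))), ∑ p₁ : GridPoint L (2 * (2 * M)),
      (if p₁.2 ≠ p₀.2 ∧ (fun j => ((p₁.2 - p₀.2) j).valMinAbs : Site 2) ∉ c.disk then
        Real.sqrt ((((p₁.2 - p₀.2) 0).valMinAbs.natAbs : ℝ) ^ 2 + (((p₁.2 - p₀.2) 1).valMinAbs.natAbs : ℝ) ^ 2) ^ (k : ℕ) *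
          ‖contr ℂ ((hubbardGridSub L M β (2 * (2 * M))).transpose * hubbardCovAboveCT L M β μ 0 0 klE0 *
                hubbardGridSub L M β (2 * (2 * M))) (((p₁, σ), 0) : GridLeg (GridPoint L (2 * (2 * M)))) ((p₀, σ), 1) *
              (contr ℂ ((hubbardGridSub L M β (2 * (2 * M))).transpose * hubbardCovAboveCT L M β μ 0 0 klE0 *
                hubbardGridSub L M β (2 * (2 * M))) (((p₀, σ.rev), 0) : GridLeg (GridPoint L (2 * (2 * M)))) ((p₁, σ.rev), 1) *
                contr ℂ ((hubbardGridSub L M β (2 * (2 * M))).transpose * hubbardCovAboveCT L M β μ 0 0 klE0 *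
                hubbardGridSub L M β (2 * (2 * M))) (((p₁, σ.rev), 0) : GridLeg (GridPoint L (2 * (2 * M)))) ((p₀, σ.rev), 1))‖
        else 0) ≤ bFar k * (((2 * (2 * M) : ℕ) : ℝ) / β))
    (hbS : ∀ k : Fin 3, (c.row k : ℝ) + bFar k ≤ bS k) :
    (∀ (σ : Fin 2) (p₀ : GridPoint L (2 * (2 * M))), ∑ p₁ : GridPoint L (2 * (2 * M)),
      (if p₁ = p₀ then (0 : ℝ) else (if p₁.2 - p₀.2 = 0 then (0 : ℝ) else 1) * ‖contr ℂ ((hubbardGridSub L M β (2 * (2 * M))).transpose * hubbardCovAboveCT L M β μ 0 0 klE0 *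
                hubbardGridSub L M β (2 * (2 * M))) (((p₁, σ), 0) : GridLeg (GridPoint L (2 * (2 * M)))) ((p₀, σ), 1) *
              (contr ℂ ((hubbardGridSub L M β (2 * (2 * M))).transpose * hubbardCovAboveCT L M β μ 0 0 klE0 *
                hubbardGridSub L M β (2 * (2 * M))) (((p₀, σ.rev), 0) : GridLeg (GridPoint L (2 * (2 * M)))) ((p₁, σ.rev), 1) *
                contr ℂ ((hubbardGridSub L M β (2 * (2 * M))).transpose * hubbardCovAboveCT L M β μ 0 0 klE0 *
                hubbardGridSub L M β (2 * (2 * M))) (((p₁, σ.rev), 0) : GridLeg (GridPoint L (2 * (2 * M)))) ((p₀, σ.rev), 1))‖) ≤ bS 0 * (((2 * (2 * M) : ℕ) : ℝ) / β)) ∧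
    (∀ k, 1 ≤ k → k ≤ 2 → ∀ (σ : Fin 2) (p₀ : GridPoint L (2 * (2 * M))), ∑ p₁ : GridPoint L (2 * (2 * M)),
      (if p₁ = p₀ then (0 : ℝ) else
        Real.sqrt ((((p₁.2 - p₀.2) 0).valMinAbs.natAbs : ℝ) ^ 2 + (((p₁.2 - p₀.2) 1).valMinAbs.natAbs : ℝ) ^ 2) ^ k * ‖contr ℂ ((hubbardGridSub L M β (2 * (2 * M))).transpose * hubbardCovAboveCT L M β μ 0 0 klE0 *
                hubbardGridSub L M β (2 * (2 * M))) (((p₁, σ), 0) : GridLeg (GridPoint L (2 * (2 * M)))) ((p₀, σ), 1) *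
              (contr ℂ ((hubbardGridSub L M β (2 * (2 * M))).transpose * hubbardCovAboveCT L M β μ 0 0 klE0 *
                hubbardGridSub L M β (2 * (2 * M))) (((p₀, σ.rev), 0) : GridLeg (GridPoint L (2 * (2 * M)))) ((p₁, σ.rev), 1) *
                contr ℂ ((hubbardGridSub L M β (2 * (2 * M))).transpose * hubbardCovAboveCT L M β μ 0 0 klE0 *
                hubbardGridSub L M β (2 * (2 * M))) (((p₁, σ.rev), 0) : GridLeg (GridPoint L (2 * (2 * M)))) ((p₀, σ.rev), 1))‖) ≤
        bS k * (((2 * (2 * M) : ℕ) : ℝ) / β)) := by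
  classical
  have hβ₀ : (0 : ℝ) < klBetaMin := by norm_num [klBetaMin]
  have hβpos : 0 < β := lt_of_lt_of_le hβ₀ hβ
  have hMpos : 0 < M := Nat.pos_of_ne_zero (NeZero.ne M)
  have hNpos : 0 < 2 * (2 * M) := by positivity
  have hNβ : 0 < (((2 * (2 * M) : ℕ) : ℝ) / β) := by positivity
  set Cg := (hubbardGridSub L M β (2 * (2 * M))).transpose * hubbardCovAboveCT L M β μ 0 0 klE0 * hubbardGridSub L M β (2 * (2 * M)) with hCg
  -- the near rows for each `k : Fin 3`
  have hnear := fun (k : Fin 3) (σ : Fin 2) (p₀ : GridPoint L (2 * (2 * M))) =>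
    nearRow_le (L := L) (M := M) c hc hμlo hμhi k (hrow k) hβ hMpos hNpos hδ hN' hR hT σ σ.rev p₀
  -- per-term splitting: near + far dominates the assembly's term
  have hsplit : ∀ (k : Fin 3) (σ : Fin 2) (p₀ p₁ : GridPoint L (2 * (2 * M))) (w0 : ℝ), 0 ≤ w0 →
      (p₁.2 ≠ p₀.2 → w0 = Real.sqrt ((((p₁.2 - p₀.2) 0).valMinAbs.natAbs : ℝ) ^ 2 + (((p₁.2 - p₀.2) 1).valMinAbs.natAbs : ℝ) ^ 2) ^ (k : ℕ)) →
      (p₁ ≠ p₀ → p₁.2 = p₀.2 → w0 = 0) →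
      (if p₁ = p₀ then (0 : ℝ) else w0 * ‖contr ℂ Cg (((p₁, σ), 0) : GridLeg (GridPoint L (2 * (2 * M)))) ((p₀, σ), 1) *
          (contr ℂ Cg (((p₀, σ.rev), 0) : GridLeg (GridPoint L (2 * (2 * M)))) ((p₁, σ.rev), 1) *
            contr ℂ Cg (((p₁, σ.rev), 0) : GridLeg (GridPoint L (2 * (2 * M)))) ((p₀, σ.rev), 1))‖) ≤
      (if p₁.2 ≠ p₀.2 ∧ (fun j => ((p₁.2 - p₀.2) j).valMinAbs : Site 2) ∈ c.disk then
        Real.sqrt ((((p₁.2 - p₀.2) 0).valMinAbs.natAbs : ℝ) ^ 2 + (((p₁.2 - p₀.2) 1).valMinAbs.natAbs : ℝ) ^ 2) ^ (k : ℕ) *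
          ‖contr ℂ Cg (((p₁, σ), 0) : GridLeg (GridPoint L (2 * (2 * M)))) ((p₀, σ), 1) *
            (contr ℂ Cg (((p₀, σ.rev), 0) : GridLeg (GridPoint L (2 * (2 * M)))) ((p₁, σ.rev), 1) *
              contr ℂ Cg (((p₁, σ.rev), 0) : GridLeg (GridPoint L (2 * (2 * M)))) ((p₀, σ.rev), 1))‖
        else 0) +
      (if p₁.2 ≠ p₀.2 ∧ (fun j => ((p₁.2 - p₀.2) j).valMinAbs : Site 2) ∉ c.disk then
        Real.sqrt ((((p₁.2 - p₀.2) 0).valMinAbs.natAbs : ℝ) ^ 2 + (((p₁.2 - p₀.2) 1).valMinAbs.natAbs : ℝ) ^ 2) ^ (k : ℕ) *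
          ‖contr ℂ Cg (((p₁, σ), 0) : GridLeg (GridPoint L (2 * (2 * M)))) ((p₀, σ), 1) *
            (contr ℂ Cg (((p₀, σ.rev), 0) : GridLeg (GridPoint L (2 * (2 * M)))) ((p₁, σ.rev), 1) *
              contr ℂ Cg (((p₁, σ.rev), 0) : GridLeg (GridPoint L (2 * (2 * M)))) ((p₀, σ.rev), 1))‖
        else 0) := by
    intro k σ p₀ p₁ w0 hw0 hwx hw00
    by_cases hp : p₁ = p₀
    · simp only [hp, if_true]
      positivity
    · simp only [hp, if_false]
      by_cases hxx : p₁.2 = p₀.2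
      · rw [hw00 hp hxx, zero_mul]
        positivity
      · rw [hwx hxx]
        by_cases hd : (fun j => ((p₁.2 - p₀.2) j).valMinAbs : Site 2) ∈ c.disk
        · rw [if_pos ⟨hxx, hd⟩, if_neg (fun h => h.2 hd), add_zero]
        · rw [if_neg (fun h => hd h.2), if_pos ⟨hxx, hd⟩, zero_add]
  refine ⟨fun σ p₀ => ?_, fun k hk1 hk2 σ p₀ => ?_⟩
  · -- k = 0: the on-site indicator weight
    have h := Finset.sum_le_sum fun p₁ (_ : p₁ ∈ (Finset.univ : Finset (GridPoint L (2 * (2 * M))))) =>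
      hsplit 0 σ p₀ p₁ (if p₁.2 - p₀.2 = 0 then (0 : ℝ) else 1) (by split_ifs <;> norm_num)
        (fun hx => by rw [if_neg (sub_ne_zero.2 hx)]; simp) (fun _ hx => by rw [if_pos (sub_eq_zero.2 hx)])
    refine h.trans ?_
    rw [Finset.sum_add_distrib]
    have h1 := hnear 0 σ p₀
    have h2 := hfar 0 σ p₀
    simp only [Fin.val_zero] at h1 h2
    calc _ ≤ (c.row 0 : ℝ) * (((2 * (2 * M) : ℕ) : ℝ) / β) + bFar 0 * (((2 * (2 * M) : ℕ) : ℝ) / β) := add_le_add h1 h2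
      _ = ((c.row 0 : ℝ) + bFar 0) * (((2 * (2 * M) : ℕ) : ℝ) / β) := by ring
      _ ≤ bS 0 * (((2 * (2 * M) : ℕ) : ℝ) / β) := mul_le_mul_of_nonneg_right (hbS 0) hNβ.le
  · -- k = 1, 2: the Euclidean weight vanishes on site
    have hk3 : k < 3 := by omega
    set kf : Fin 3 := ⟨k, hk3⟩ with hkf
    have hkval : (kf : ℕ) = k := rfl
    have h := Finset.sum_le_sum fun p₁ (_ : p₁ ∈ (Finset.univ : Finset (GridPoint L (2 * (2 * M))))) =>
      hsplit kf σ p₀ p₁ (Real.sqrt ((((p₁.2 - p₀.2) 0).valMinAbs.natAbs : ℝ) ^ 2 + (((p₁.2 - p₀.2) 1).valMinAbs.natAbs : ℝ) ^ 2) ^ k)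
        (by positivity) (fun _ => by rw [hkval]) (fun _ hx => by
          have hk0 : k ≠ 0 := by omega
          simp [hx, Real.sqrt_zero, zero_pow hk0])
    refine h.trans ?_
    rw [Finset.sum_add_distrib]
    have h1 := hnear kf σ p₀
    have h2 := hfar kf σ p₀
    simp only [hkval] at h1 h2
    calc _ ≤ (c.row kf : ℝ) * (((2 * (2 * M) : ℕ) : ℝ) / β) + bFar k * (((2 * (2 * M) : ℕ) : ℝ) / β) := add_le_add h1 h2
      _ = ((c.row kf : ℝ) + bFar k) * (((2 * (2 * M) : ℕ) : ℝ) / β) := by ring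
      _ ≤ bS k * (((2 * (2 * M) : ℕ) : ℝ) / β) := mul_le_mul_of_nonneg_right (hbS kf) hNβ.le

end Summit.HubbardSuperconductivity.HubbardSuperconductivity.Theorems.KLRegimeSplit

end
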